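import Summits.BirchSwinnertonDyer.Rank1Residual.Additive.WildThreeNonsplitTransfer
import HarnessLib

/-!
# O6 — T-O6-R6, §4 (G6-8): the toric lattice model at `q = 5` (decidable EVIDENCE)
# (cell `b2b-bsdres`, o6-r2 GEN 6; split from `WildThreeNonsplitTransfer.lean` by the typer, cc-typer-5
# GEN 4, because Summit files are ≤ 400 lines — content VERBATIM from o6-r2's file sha16 82640b8549bc036b
# §4, plus lint-only `[folklore]` docstrings; nothing about curves is asserted)

HONEST FRAMING (cell `b2b-bsdres`, verbatim in every file): the goal of the cell is to DELETE the
COMBINATION-SHAPED residual classes of the Birch–Swinnerton-Dyer formula for ALL analytic-rank `≤ 1`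
elliptic curves over `ℚ` — assembled STRICTLY from published theorems — so that the rank-`≤ 1` remainder
becomes exactly the CONSTRUCTION-SHAPED classes, which are TYPED (missing-input `Prop`s), NOT attempted.
This is not "finishing BSD". Research routes; no claim beyond stated classes; census output = EVIDENCE /
conjecture items, never a Literature fact. This file is a DECIDABLE MODEL computation (kernel-checked
arithmetic in the lattice `{x : Fin 5 → ℤ | Σ x = 0}` with its `S₅ ≅ PGL₂(𝔽₅)`-action): EVIDENCE for the
SHAPE of the toric degree law T-O6-R6⁺ at `q = 5`; the identification of the model with `Hom(J, E)` and
its degree form is the untyped content of T-O6-R6⁺ (`WildThreeNonsplitTransfer.lean`, module docstring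
G6-8 and the node `NonsplitTamagawaCancellationAtThree`). 0 facts; nothing booked; no mark moves.
-/

namespace Summit.BirchSwinnertonDyer.Rank1Residual.AdditiveThree

/-! ## §4. G6-8 — the toric lattice model at `q = 5` (decidable EVIDENCE) -/

/-! ### G6-8 rung — the toric degree law at `q = 5`, by hand in `PGL₂(𝔽₅) ≅ S₅`

`PGL₂(𝔽₅) ≅ S₅`; the cuspidal representations of dimension `q − 1 = 4` are `std` (`= σ_θ`, `θ` of order `6`,
Kodaira II/II*) and `std ⊗ sgn` (`= σ_θ`, `θ` of order `3`, Kodaira IV/IV*): transpositions are the elliptic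
involutions (centraliser order `12 = 2(q+1)`), on which `χ_{θ₃} = −2`, `χ_{θ₆} = +2`.  The image of the non-split
torus is `T̄_ns = ⟨(0 1)(2 3 4)⟩` (order `6 = q+1`), of the split torus `T̄_s = ⟨(0 1 2 3)⟩` (order `4 = q−1`).
Model lattice: `L = {x : Fin 5 → ℤ | Σ x = 0}` with the dot product, `S₅` acting by `x ↦ x ∘ g` (resp. `sgn(g) · (x ∘ g)`).
TORIC DEGREE LAW (model form, EVIDENCE): `(q+1) · Q(v_s) = #Φ_q(𝔽_{q²}) · (q−1) · Q(v_ns)` with `#Φ = 1` (II/II*) and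
`3` (IV/IV*), `v_•` the primitive torus-fixed vectors.  Everything below is decided by the kernel. -/
namespace ToricLawAtFive

/-- `(0 1)(2 3 4)` as a function `i ↦ g i` (an odd permutation, `sgn = −1`). -/
def tns : Fin 5 → Fin 5 := ![1, 0, 3, 4, 2]
/-- `(0 1 2 3)` (odd, `sgn = −1`). -/
def ts : Fin 5 → Fin 5 := ![1, 2, 3, 0, 4]
/-- the degree form of the model lattice: `Q(x) = Σ xᵢ²`. -/
def Q (x : Fin 5 → ℤ) : ℤ := x 0 ^ 2 + x 1 ^ 2 + x 2 ^ 2 + x 3 ^ 2 + x 4 ^ 2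
/-- membership in the standard lattice `Σ xᵢ = 0`. A predicate; nothing asserted. [folklore] -/
def InStd (x : Fin 5 → ℤ) : Prop := x 0 + x 1 + x 2 + x 3 + x 4 = 0
/-- `InStd` is decidable (lint-only docstring added by the typer). [folklore] -/
instance (x : Fin 5 → ℤ) : Decidable (InStd x) := inferInstanceAs (Decidable (x 0 + x 1 + x 2 + x 3 + x 4 = 0))

/-- θ of order 6 (`std`, Kodaira II/II*): the primitive `T̄_ns`-fixed vector. -/
def vns6 : Fin 5 → ℤ := ![3, 3, -2, -2, -2]
/-- θ of order 6: the primitive `T̄_s`-fixed vector. -/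
def vs6 : Fin 5 → ℤ := ![1, 1, 1, 1, -4]
/-- θ of order 3 (`std ⊗ sgn`, Kodaira IV/IV*): the primitive `T̄_ns`-fixed vector (twisted action). -/
def vns3 : Fin 5 → ℤ := ![1, -1, 0, 0, 0]
/-- θ of order 3: the primitive `T̄_s`-fixed vector (twisted action). -/
def vs3 : Fin 5 → ℤ := ![1, -1, 1, -1, 0]

/-- `vns6` lies in the standard lattice (lint-only docstring). [folklore] -/
theorem vns6_inStd : InStd vns6 := by decide
/-- `vs6` lies in the standard lattice (lint-only docstring). [folklore] -/
theorem vs6_inStd : InStd vs6 := by decide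
/-- `vns3` lies in the standard lattice (lint-only docstring). [folklore] -/
theorem vns3_inStd : InStd vns3 := by decide
/-- `vs3` lies in the standard lattice (lint-only docstring). [folklore] -/
theorem vs3_inStd : InStd vs3 := by decide

/-- fixedness under the tori (plain action for `std`, sign-twisted for `std ⊗ sgn`; both generators are odd). -/
theorem vns6_fixed : ∀ i, vns6 (tns i) = vns6 i := by decide
/-- `vs6` is fixed by the split torus generator (lint-only docstring). [folklore] -/
theorem vs6_fixed : ∀ i, vs6 (ts i) = vs6 i := by decide
/-- `vns3` is fixed by the non-split torus generator, twisted action (lint-only docstring). [folklore] -/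
theorem vns3_fixed : ∀ i, -vns3 (tns i) = vns3 i := by decide
/-- `vs3` is fixed by the split torus generator, twisted action (lint-only docstring). [folklore] -/
theorem vs3_fixed : ∀ i, -vs3 (ts i) = vs3 i := by decide

/-- … and they GENERATE the fixed sublattices (rank one, primitive). -/
theorem vns6_generates (x : Fin 5 → ℤ) (hs : InStd x) (hf : ∀ i, x (tns i) = x i) :
    ∀ i, x i = (x 0 + x 2) * vns6 i := by
  have h0 : x 1 = x 0 := hf 0
  have h2 : x 3 = x 2 := hf 2
  have h3 : x 4 = x 3 := hf 3
  unfold InStd at hs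
  intro i; fin_cases i <;> simp [vns6] <;> omega
/-- `vs6` generates the split-torus-fixed sublattice (lint-only docstring). [folklore] -/
theorem vs6_generates (x : Fin 5 → ℤ) (hs : InStd x) (hf : ∀ i, x (ts i) = x i) :
    ∀ i, x i = x 0 * vs6 i := by
  have h0 : x 1 = x 0 := hf 0
  have h1 : x 2 = x 1 := hf 1
  have h2 : x 3 = x 2 := hf 2
  unfold InStd at hs
  intro i; fin_cases i <;> simp [vs6] <;> omega
/-- `vns3` generates the twisted non-split-torus-fixed sublattice (lint-only docstring). [folklore] -/
theorem vns3_generates (x : Fin 5 → ℤ) (hf : ∀ i, -x (tns i) = x i) :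
    ∀ i, x i = x 0 * vns3 i := by
  have h0 : -x 1 = x 0 := hf 0
  have h2 : -x 3 = x 2 := hf 2
  have h3 : -x 4 = x 3 := hf 3
  have h4 : -x 2 = x 4 := hf 4
  intro i; fin_cases i <;> simp [vns3] <;> omega
/-- `vs3` generates the twisted split-torus-fixed sublattice (lint-only docstring). [folklore] -/
theorem vs3_generates (x : Fin 5 → ℤ) (hf : ∀ i, -x (ts i) = x i) :
    ∀ i, x i = x 0 * vs3 i := by
  have h0 : -x 1 = x 0 := hf 0
  have h1 : -x 2 = x 1 := hf 1
  have h2 : -x 3 = x 2 := hf 2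
  have h4 : -x 4 = x 4 := hf 4
  intro i; fin_cases i <;> simp [vs3] <;> omega

/-- `Q(vns6) = 30` (lint-only docstring). [folklore] -/
theorem Q_vns6 : Q vns6 = 30 := by decide
/-- `Q(vs6) = 20` (lint-only docstring). [folklore] -/
theorem Q_vs6 : Q vs6 = 20 := by decide
/-- `Q(vns3) = 2` (lint-only docstring). [folklore] -/
theorem Q_vns3 : Q vns3 = 2 := by decide
/-- `Q(vs3) = 4` (lint-only docstring). [folklore] -/
theorem Q_vs3 : Q vs3 = 4 := by decide

/-- **TORIC DEGREE LAW at q = 5, Kodaira II/II*** (`#Φ₅(𝔽₂₅) = 1`): `(q+1)·Q(v_s) = 1·(q−1)·Q(v_ns)`. -/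
theorem toricLawAtFive_II : (5 + 1) * Q vs6 = 1 * ((5 - 1) * Q vns6) := by decide
/-- **TORIC DEGREE LAW at q = 5, Kodaira IV/IV*** (`#Φ₅(𝔽₂₅) = 3`): `(q+1)·Q(v_s) = 3·(q−1)·Q(v_ns)`, i.e. with
`δ_Y = λ_Y² Q(v_Y)/|T̄_Y|` and `λ = 1`:  `δ₁/δ_ns = 3` — the non-split Cartan parametrisation absorbs exactly the
inert Tamagawa `3`. -/
theorem toricLawAtFive_IV : (5 + 1) * Q vs3 = 3 * ((5 - 1) * Q vns3) := by decide

end ToricLawAtFive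

end Summit.BirchSwinnertonDyer.Rank1Residual.AdditiveThree
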